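import Literature.Geometry.Lorentzian.Basic
import Literature.Geometry.Lorentzian.CoordCurvature
import HarnessLib

/-!
# Crux `GapExhaustion` (stmt-FinalStateConjecture-10808), line `photon-shell-pseudoconvexity`:
# stub (K-A1) `stub_killingHessianSkew` — the differentiated skewness of `∇K` for a coordinate
# Killing field

Route `BartnikGapSettling`; helper (`--supports stmt-FinalStateConjecture-10808`) landing the
registered sub-stub (K-A1) of line lead c8, wave 2 (LOCAL unique continuation of Killing fields
in coordinates — the patching tool of the Ionescu–Klainerman sweeps S3/S5/S6b). Let `G` be the
components of a pseudo-Riemannian metric on the open set `V ⊆ E4` (`IsMetricOn`), `Γ = chrAt G`,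
and `K : E4 → E4` a `C²` solution of the coordinate Killing equation
`DG(x)(K x)(Y,Z) + G x (DK(x) Y) Z + G x Y (DK(x) Z) = 0` on `V`. With `A_y Y := DK(y) Y + Γ_y(Y, K y)`
(`= ∇_Y K`) and `B(X,Y,Z) := G_x(∂_X(A·Y)(x) + Γ_x(X, A_x Y) − A_x(Γ_x(X,Y)), Z)`
(`= G((∇_X ∇K) Y, Z)`), we prove `B(X,Y,Z) + B(X,Z,Y) = 0`: the covariant derivative of the
skew-adjoint endomorphism `∇K` is skew-adjoint (O'Neill 1983, Ch. 9, proof of Lemma 9.27 /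
Exercise 8; Kobayashi–Nomizu I, Ch. VI, §2).

Proof: the Killing equation and metric compatibility (`IsMetricOn.fderiv_eq_chrAt`, torsion-free
`Γ`) give the pointwise skewness `G_y(A_y u, v) + G_y(A_y v, u) = 0` at every `y ∈ V`; hence the
function `y ↦ G_y(A_y Y, Z) + G_y(A_y Z, Y)` vanishes on the open `V`, so its derivative at `x`
along `X` vanishes; expanding that derivative by the Leibniz rule and metric compatibility, and
using the pointwise skewness at `x` on the pairs `(Γ(X,Y), Z)`, `(Γ(X,Z), Y)`, gives the claim.
-/

noncomputable section

-- instance search through the nested operator types `E4 →L[ℝ] E4 →L[ℝ] E4 →L[ℝ] ℝ`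
set_option maxSynthPendingDepth 3

-- D-0017: single-problem summit, `Summit.<S>.<S>.…` by design (cf. lakefile `weak.linter.dupNamespace`).
set_option linter.dupNamespace false

namespace Summit.FinalStateConjecture.FinalStateConjecture.Theorems

open Set Filter
open Literature.Geometry.Lorentzian Literature.Geometry.Lorentzian.MetricCoord
open scoped Topology

/-- A `C²` map on the open set `V` of a metric datum has a differentiable derivative at the points
of `V`. [folklore] -/
private theorem killingHessianSkew_differentiableAt_fderiv
    {G : E4 → E4 →L[ℝ] E4 →L[ℝ] ℝ} {V : Set E4} {K : E4 → E4} (hG : IsMetricOn G V)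
    (hK : ContDiffOn ℝ 2 K V) {x : E4} (hx : x ∈ V) :
    DifferentiableAt ℝ (fderiv ℝ K) x :=
  (((hK x hx).contDiffAt (hG.mem_nhds hx)).fderiv_right (m := 1) (by norm_num)).differentiableAt
    one_ne_zero

/-- A `C²` map on the open set `V` of a metric datum is differentiable at the points of `V`.
[folklore] -/
private theorem killingHessianSkew_differentiableAt
    {G : E4 → E4 →L[ℝ] E4 →L[ℝ] ℝ} {V : Set E4} {K : E4 → E4} (hG : IsMetricOn G V)
    (hK : ContDiffOn ℝ 2 K V) {x : E4} (hx : x ∈ V) :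
    DifferentiableAt ℝ K x :=
  ((hK x hx).contDiffAt (hG.mem_nhds hx)).differentiableAt two_ne_zero

/-- The field `y ↦ A_y Y = DK(y) Y + Γ_y(Y, K y)` is differentiable at the points of `V`.
[folklore] -/
private theorem killingHessianSkew_differentiableAt_A
    {G : E4 → E4 →L[ℝ] E4 →L[ℝ] ℝ} {V : Set E4} {K : E4 → E4} (hG : IsMetricOn G V)
    (hK : ContDiffOn ℝ 2 K V) {x : E4} (hx : x ∈ V) (Y : E4) :
    DifferentiableAt ℝ (fun y => fderiv ℝ K y Y + chrAt G y Y (K y)) x :=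
  (differentiableAt_clm_apply_const (killingHessianSkew_differentiableAt_fderiv hG hK hx) Y).add
    ((differentiableAt_clm_apply_const (hG.differentiableAt_chrAt hx) Y).clm_apply
      (killingHessianSkew_differentiableAt hG hK hx))

/-- **Pointwise skewness of `∇K`** for a coordinate Killing field: at every `y ∈ V` and for all
vectors `u, v`, `G_y(A_y u, v) + G_y(A_y v, u) = 0` (Killing equation + metric compatibility
`∂_K G(u,v) = G(Γ(K,u), v) + G(u, Γ(K,v))` + torsion-freeness `Γ(K,u) = Γ(u,K)`).
[cite: ONeill1983, Ch. 9, Prop. 9.25] -/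
private theorem killingHessianSkew_skew
    {G : E4 → E4 →L[ℝ] E4 →L[ℝ] ℝ} {V : Set E4} {K : E4 → E4} (hG : IsMetricOn G V)
    (hKil : ∀ x ∈ V, ∀ Y Z : E4,
      fderiv ℝ G x (K x) Y Z + G x (fderiv ℝ K x Y) Z + G x Y (fderiv ℝ K x Z) = 0)
    {y : E4} (hy : y ∈ V) (u v : E4) :
    G y (fderiv ℝ K y u + chrAt G y u (K y)) v + G y (fderiv ℝ K y v + chrAt G y v (K y)) u = 0 := by
  have h := hKil y hy u v
  rw [hG.fderiv_eq_chrAt hy (K y) u v, hG.chrAt_comm hy (K y) u, hG.chrAt_comm hy (K y) v,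
    hG.symm y hy u (chrAt G y v (K y)), hG.symm y hy u (fderiv ℝ K y v)] at h
  simp only [map_add, add_apply]
  linarith

/-- **Stub (K-A1) of the line `photon-shell-pseudoconvexity` (crux `GapExhaustion`,
stmt-FinalStateConjecture-10808) — the differentiated skewness of `∇K`.** For the components `G`
of a pseudo-Riemannian metric on the open set `V ⊆ E4`, a `C²` map `K` satisfying the coordinate
Killing equation on `V`, every `x ∈ V` and all `X Y Z : E4`:
`B(X,Y,Z) + B(X,Z,Y) = 0`, where `B(X,Y,Z) = G_x(∂_X(A·Y)(x) + Γ_x(X, A_x Y) − A_x(Γ_x(X,Y)), Z)`,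
`A_y Y = DK(y) Y + Γ_y(Y, K y)` — i.e. `G((∇_X∇K)Y, Z)` is skew in `(Y, Z)` (O'Neill 1983,
Ch. 9, proof of Lemma 9.27 / Exercise 8). Differentiate the pointwise skewness
`G_y(A_y Y, Z) + G_y(A_y Z, Y) = 0` (valid on the open `V`) at `x` along `X`, expand by the
Leibniz rule and metric compatibility, and use the pointwise skewness at `x` on the pairs
`(Γ(X,Y), Z)` and `(Γ(X,Z), Y)`. [folklore] -/
theorem stub_killingHessianSkew :
    ∀ (G : E4 → E4 →L[ℝ] E4 →L[ℝ] ℝ) (V : Set E4) (K : E4 → E4),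
      IsMetricOn G V → ContDiffOn ℝ 2 K V →
      (∀ x ∈ V, ∀ Y Z : E4,
        fderiv ℝ G x (K x) Y Z + G x (fderiv ℝ K x Y) Z + G x Y (fderiv ℝ K x Z) = 0) →
      ∀ x ∈ V, ∀ X Y Z : E4,
        G x (fderiv ℝ (fun y => fderiv ℝ K y Y + chrAt G y Y (K y)) x X
            + chrAt G x X (fderiv ℝ K x Y + chrAt G x Y (K x))
            - (fderiv ℝ K x (chrAt G x X Y) + chrAt G x (chrAt G x X Y) (K x))) Z
        + G x (fderiv ℝ (fun y => fderiv ℝ K y Z + chrAt G y Z (K y)) x X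
            + chrAt G x X (fderiv ℝ K x Z + chrAt G x Z (K x))
            - (fderiv ℝ K x (chrAt G x X Z) + chrAt G x (chrAt G x X Z) (K x))) Y = 0 := by
  intro G V K hG hK hKil x hx X Y Z
  -- the two `∇K`-fields `a_Y`, `a_Z` and their derivatives at `x`
  set aY : E4 → E4 := fun y => fderiv ℝ K y Y + chrAt G y Y (K y) with haY
  set aZ : E4 → E4 := fun y => fderiv ℝ K y Z + chrAt G y Z (K y) with haZ
  have haYd : HasFDerivAt aY (fderiv ℝ aY x) x :=
    (killingHessianSkew_differentiableAt_A hG hK hx Y).hasFDerivAt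
  have haZd : HasFDerivAt aZ (fderiv ℝ aZ x) x :=
    (killingHessianSkew_differentiableAt_A hG hK hx Z).hasFDerivAt
  have hGd : HasFDerivAt G (fderiv ℝ G x) x := (hG.differentiableAt hx).hasFDerivAt
  -- the function `φ y = G_y(a_Y y, Z) + G_y(a_Z y, Y)` vanishes on `V`, hence near `x`
  have hφ0 : (fun y => G y (aY y) Z + G y (aZ y) Y) =ᶠ[𝓝 x] fun _ => (0 : ℝ) :=
    (hG.eventually_mem hx).mono fun y hy => killingHessianSkew_skew hG hKil hy Y Z
  -- its derivative at `x`
  have h1 : HasFDerivAt (fun y => G y (aY y) Z)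
      (((G x).comp (fderiv ℝ aY x) + (fderiv ℝ G x).flip (aY x)).flip Z) x :=
    hasFDerivAt_clm_apply_const (hGd.clm_apply haYd) Z
  have h2 : HasFDerivAt (fun y => G y (aZ y) Y)
      (((G x).comp (fderiv ℝ aZ x) + (fderiv ℝ G x).flip (aZ x)).flip Y) x :=
    hasFDerivAt_clm_apply_const (hGd.clm_apply haZd) Y
  have hφ : HasFDerivAt (fun y => G y (aY y) Z + G y (aZ y) Y)
      (((G x).comp (fderiv ℝ aY x) + (fderiv ℝ G x).flip (aY x)).flip Z
        + ((G x).comp (fderiv ℝ aZ x) + (fderiv ℝ G x).flip (aZ x)).flip Y) x :=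
    h1.add h2
  have hderiv0 : fderiv ℝ (fun y => G y (aY y) Z + G y (aZ y) Y) x = 0 := by
    rw [hφ0.fderiv_eq]
    exact fderiv_const_apply 0
  have hX : (((G x).comp (fderiv ℝ aY x) + (fderiv ℝ G x).flip (aY x)).flip Z
      + ((G x).comp (fderiv ℝ aZ x) + (fderiv ℝ G x).flip (aZ x)).flip Y) X = 0 := by
    rw [← hφ.fderiv, hderiv0]
    rfl
  have hexp : G x (fderiv ℝ aY x X) Z + fderiv ℝ G x X (aY x) Z
      + (G x (fderiv ℝ aZ x X) Y + fderiv ℝ G x X (aZ x) Y) = 0 := by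
    simpa only [add_apply, ContinuousLinearMap.flip_apply, ContinuousLinearMap.comp_apply]
      using hX
  -- metric compatibility on the two `DG` terms, pointwise skewness on the `A(Γ(·,·))` terms
  rw [hG.fderiv_eq_chrAt hx X (aY x) Z, hG.fderiv_eq_chrAt hx X (aZ x) Y] at hexp
  have hs1 := killingHessianSkew_skew hG hKil hx (chrAt G x X Y) Z
  have hs2 := killingHessianSkew_skew hG hKil hx (chrAt G x X Z) Y
  have e1 : aY x = fderiv ℝ K x Y + chrAt G x Y (K x) := rfl
  have e2 : aZ x = fderiv ℝ K x Z + chrAt G x Z (K x) := rfl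
  rw [e1, e2] at hexp
  rw [← e1, ← e2] at hexp ⊢
  rw [← e2] at hs1
  rw [← e1] at hs2
  simp only [map_add, map_sub, add_apply, sub_apply] at hexp hs1 hs2 ⊢
  have hsy1 : G x (aZ x) (chrAt G x X Y) = G x (chrAt G x X Y) (aZ x) :=
    hG.symm x hx _ _
  have hsy2 : G x (aY x) (chrAt G x X Z) = G x (chrAt G x X Z) (aY x) :=
    hG.symm x hx _ _
  linarith

end Summit.FinalStateConjecture.FinalStateConjecture.Theorems

end
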